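import Summits.BirchSwinnertonDyer.BirchSwinnertonDyer.Theorems.AdditiveRankOneLowerHalfOfUnrFrame
import Summits.BirchSwinnertonDyer.BirchSwinnertonDyer.Theorems.AdditiveWildRankOneTowerSurjOfKato
import HarnessLib

/-!
# K9's residual `WildRankOne` (19200) on the `3`-adic TOWER-SURJECTIVE rows from the TEXTS of the bsd-wall cruxes — UTD 20928
# (`R₀`-frame), SOED 20479 (Eisenstein inclusion X), SOED 20480 (Kolyvagin bound Ko) — and K9's own L₀ `WildLowerHalfRankZero`:
# an alternative kernel for route SOED's cell that needs only the LOWER half of the rank-zero twist (its UPPER half is Kato A161″)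

Prover seat `bsd-potss-kmc`, gen 20 (cell `bsd-potss`; K9 route `KatoDescentPotSupersingular`, residual 19200; routes UTD / SOED of
cell bsd-wall), 2026-08-27. HONEST FRAMING: CONDITIONAL on every displayed hypothesis; 0 definitions, 0 named facts minted, 0 `sorry`;
closes nothing; BSD₃ for no curve; no route statement is imported by name (texts restated VERBATIM; glue = `fun h₁ h₂ h₃ h₄ => …`).

Route SOED's kernel `EisensteinKernelAtThree` (20485, bed-p3) reads BSD₃ on the onto ∧ tower wild rank-one rows from X (20479), Ko
(20480), the value (20385, now 20928 + LZZ), control (20386, closed modulo eight facts by kmc g16/g17) and the FULL rank-zero leaf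
`WildRankZeroTwistAtThree := WAllExclAddWildRankZero` (BSD₃ of the twist). Gen 20's half kernels show the twist's UPPER half is
Kato's Tamagawa-exact bound on these rows, so only its LOWER half — K9's crux L₀ `WildLowerHalfRankZero` (19195) — is needed:

* **`bsdp_wildRankOne_towerSurj_of_frame20928_of_eisenstein20479_of_kolyvagin20480_of_L0_of_katoTam_of_facts`** —
  `∀ W, r_an = 1 → ClassO6 W 3 → TowerSurjThree W → BSDp W 3` ⟸ [text of 20928] ∧ [text of 20479] ∧ [text of 20480] ∧ [text of
  19195 `WildLowerHalfRankZero`] ∧ Kato A161″ ∧ {Poitou–Tate ×2, local Euler–Poincaré, cd ≤ 2, Brink Thm 2 / Cor 1, Serre 1967} ∧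
  LZZ 2018 ∧ ToricPublishedInputs; `missingPPartAt_…` in 19200's currency.

References: [Castella2018] Thm 3.1, §3; [JetchevSkinnerWan2017] §7.4.1, Thm. 3.3.1; [Jetchev2008] Thm 1.4; [LiuZhangZhang2018]
Thm 1.5.1/1.5.3; [Kato2004Asterisque] Thm. 14.5 (3), Prop. 14.16 (2); [GrossZagier1986] I.(6.3), Thm. I.7.3; [SilvermanATAEC1994] IV.9.4;
[Serre1967GroupesPDivisibles] §5 Prop. 8.
-/

noncomputable section

open scoped Classical

set_option linter.dupNamespace false
set_option autoImplicit false

namespace Summit.BirchSwinnertonDyer.BirchSwinnertonDyer.Theorems.UniversalToricDescentWaldspurgerFlat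

open WeierstrassCurve NumberField IsDedekindDomain Field PowerSeries
  Literature.NumberTheory.EllipticCurves
  Literature.NumberTheory.EllipticCurves.ModularForms
  Literature.NumberTheory.EllipticCurves.Rank1Residual
  Literature.NumberTheory.EllipticCurves.Rank1Residual.Typed
  Literature.NumberTheory.EllipticCurves.KrizLi2019
  Literature.NumberTheory.GaloisRepresentations
  Literature.NumberTheory.GaloisCohomology
  Summit.BirchSwinnertonDyer.Rank1Residual
  Summit.BirchSwinnertonDyer.Rank1Residual.Additive
  Summit.BirchSwinnertonDyer.Rank1Residual.X11b
  Summit.BirchSwinnertonDyer.Rank1Residual.X11b.AcSelmer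
  Summit.BirchSwinnertonDyer.Rank1Residual.X11b.Halves
  Summit.BirchSwinnertonDyer.Rank1Residual.X11b.CongruenceLimit
  Summit.BirchSwinnertonDyer.BirchSwinnertonDyer.Theses.UniversalToricDescent
  Summit.BirchSwinnertonDyer.BirchSwinnertonDyer.Theorems.AdditivePotSupersingularControl

section RouteTexts

variable [Fact (3 : ℕ).Prime]

/-- **K9's `WildRankOne` on the TOWER-SURJECTIVE rows from the texts of UTD 20928, SOED 20479, SOED 20480 and K9 19195
(modulo Kato A161″, seven cohomological facts, LZZ, published inputs).** The two index sockets at the Friedberg–Hoffstein datum: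
STEP L from the `R₀`-frame (20928) + the Eisenstein inclusion (20479, torsion guard fed by control) + control
(`additiveControl_heegner_potSS_of_facts_of_serre1967`) + the value (LZZ) — `indexLowerBoundLeAt_of_unrFrame_of_unrInclLe_of_control`;
co-STEP L = Ko (20480: `ρ̄₃` onto from the tower, `d_K ≠ −3` from `d_K < −4`). The twist's halves: LOWER = K9's L₀ at `E^{(d_K)}`
(again wild, `r_an = 0`: `classO6_twist_of_heegner`), UPPER = Kato A161″ (`missingUpperBoundAt_twist_of_towerSurj_of_katoTam`). Then
`bsdp_of_indexHalves_of_twistHalvesOdd_row`. CONDITIONAL; closes nothing; BSD₃ for no curve.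
[cite: JetchevSkinnerWan2017, §7.4.1 and Thm. 3.3.1 (arXiv:1512.06894)] [cite: Castella2018, Thm. 3.1 and §3 (arXiv:1704.06608 pp. 8–9)]
[cite: Kato2004Asterisque, Thm. 14.5 (3), Prop. 14.16 (2)] [cite: Jetchev2008, Thm. 1.4 and Conj. 1.3]
[cite: LiuZhangZhang2018, Thm 1.5.1 and Thm 1.5.3 (Duke Math. J. 167 pp. 748–749)] [cite: SilvermanATAEC1994, IV.9.4 (PDF pp. 344–346)]
[cite: Serre1967GroupesPDivisibles, §5 Prop. 8] [cite: GrossZagier1986, I.(6.3) and Thm. I.7.3] -/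
theorem bsdp_wildRankOne_towerSurj_of_frame20928_of_eisenstein20479_of_kolyvagin20480_of_L0_of_katoTam_of_facts
    (hL : LiuZhangZhang2018.thm151_thm153_modularCurve_heegnerVector_additive)
    (hF : ToricPublishedInputs)
    (hKatoT : Kato2004.rankZero_padicValNat_sha_add_padicValNat_tamagawa_le_of_additive_potGood_of_imageContainsSL2)
    (hPT : ∀ (K : Type) [Field K] [NumberField K], poitouTate_selmerStructure_duality K)
    (hPT2 : ∀ (K : Type) [Field K] [NumberField K], poitouTate_sha_tateDual K)
    (hEP : ∀ (K : Type) [Field K] [NumberField K] (v : HeightOneSpectrum (𝓞 K)),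
      localEulerPoincareCharacteristic (v.adicCompletion K))
    (hcd : fieldCdLE_two_of_numberField)
    (hBr : ∀ (K : Type) [Field K] [NumberField K] (p : ℕ) [Fact p.Prime],
      ZpExtension.decomp_not_le_kerSubgroup_of_isAnticyclotomic K p)
    (hBr2 : ∀ (K : Type) [Field K] [NumberField K] (p : ℕ) [Fact p.Prime],
      ZpExtension.decomp_not_le_kerSubgroup_above_of_isAnticyclotomic K p)
    (hS : Serre1967.noStableDivisibleLine_of_potentiallySupersingular)
    (hFr : ∀ (W : WeierstrassCurve ℚ) [W.IsElliptic] [W.IsGloballyMinimal] (N : ℕ) [NeZero N] (K : Type) [Field K]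
      [NumberField K] (Dt : ModularParametrizationData W N), ClassO6 W 3 → W.conductorNorm ℤ = N → IsImaginaryQuadratic K →
      SatisfiesHeegnerHypothesis N K → ∀ (κ : ZpExtension K 3), κ.IsAnticyclotomic →
      ∀ (γ : Field.absoluteGaloisGroup K) [Fact (κ.IsTopGenerator γ)] (𝔭 : HeightOneSpectrum (𝓞 K)),
        ((3 : ℕ) : 𝓞 K) ∈ 𝔭.asIdeal → ∃ ι' : PadicAlgCl 3 ≃+* ℂ, SchneiderFree.BranchInducesPrime 3 ι' 𝔭 ∧
          ∃ (ΩK : ℂ) (Ωp : ℂ_[3]) (L : UnrSeries 3), ΩK ≠ 0 ∧ Ωp ≠ 0 ∧ IsBDPLFunction ι' 𝔭 κ γ Dt.f ΩK Ωp L)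
    (hX : ∀ (W : WeierstrassCurve ℚ) [W.IsElliptic] [W.IsGloballyMinimal] (N : ℕ) [NeZero N] (K : Type) [Field K]
      [NumberField K] (Dt : ModularParametrizationData W N), ClassO6 W 3 → W.HasSurjectiveModNGaloisRep 3 →
      W.analyticRank = 1 → W.conductorNorm ℤ = N → IsImaginaryQuadratic K → SatisfiesHeegnerHypothesis N K →
      ∀ (κ : ZpExtension K 3), κ.IsAnticyclotomic → ∀ (γ : Field.absoluteGaloisGroup K) [Fact (κ.IsTopGenerator γ)]
        (𝔭 : HeightOneSpectrum (𝓞 K)), ((3 : ℕ) : 𝓞 K) ∈ 𝔭.asIdeal → 𝔭.asIdeal.ramificationIdx (𝓞 ℚ) = 1 →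
        𝔭.asIdeal.inertiaDeg (𝓞 ℚ) = 1 → ∀ (𝔭' : HeightOneSpectrum (𝓞 K)), ((3 : ℕ) : 𝓞 K) ∈ 𝔭'.asIdeal → 𝔭' ≠ 𝔭 →
        ∀ (ι' : PadicAlgCl 3 ≃+* ℂ), SchneiderFree.BranchInducesPrime 3 ι' 𝔭 →
        ∀ (ΩK : ℂ) (Ωp : ℂ_[3]) (L : UnrSeries 3), ΩK ≠ 0 → Ωp ≠ 0 → IsBDPLFunction ι' 𝔭 κ γ Dt.f ΩK Ωp L →
          Module.IsTorsion (IwasawaAlgebra 3) (XAc (W.baseChange K) 3 κ 𝔭' ∅ γ) →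
          (XAc.charIdeal (W.baseChange K) 3 κ 𝔭' ∅ γ).map (PowerSeries.map (toUnr 3)) ≤ Ideal.span {L})
    (hKo : ∀ (W : WeierstrassCurve ℚ) [W.IsElliptic] [W.IsGloballyMinimal] (N : ℕ) [NeZero N] (K : Type) [Field K]
      [NumberField K] (Dt : ModularParametrizationData W N) (H : HeegnerDatum N (NumberField.discr K)) (ι : K →+* ℂ)
      (P : (W.baseChange K).toAffine.Point), ClassO6 W 3 → W.HasSurjectiveModNGaloisRep 3 → W.analyticRank = 1 →
      W.conductorNorm ℤ = N → IsImaginaryQuadratic K → SatisfiesHeegnerHypothesis N K →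
      (W.quadraticTwist (NumberField.discr K : ℚ)).entireLFunction 1 ≠ 0 →
      WeierstrassCurve.Affine.Point.map ι.toRatAlgHom P = heegnerPointComplex Dt H → ¬ IsOfFinAddOrder P →
      Odd (NumberField.discr K) → NumberField.discr K ≠ -3 → AdditiveThree.TowerSurjThree W →
      SchneiderFree.Upper.IndexUpperBoundLeAt W 3 K P (padicValNat 3 Dt.c.natAbs))
    (hL0 : ∀ (W : WeierstrassCurve ℚ) [W.IsElliptic] [W.IsGloballyMinimal] [Fact (3 : ℕ).Prime], W.analyticRank = 0 →
      ClassO6 W 3 → MissingLowerBoundAt W 3) :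
    ∀ (W : WeierstrassCurve ℚ) [W.IsElliptic] [W.IsGloballyMinimal], W.analyticRank = 1 → ClassO6 W 3 →
      AdditiveThree.TowerSurjThree W → BSDp W 3 := by
  intro W _ _ hr hO6 hT
  have hsurj := forall_hasSurjectiveModNGaloisRep_pow_three_of_towerSurjThree W hT
  have h1 : W.HasSurjectiveModNGaloisRep 3 := by
    have h := hsurj 1
    simp only [pow_one] at h
    exact_mod_cast h
  have haddv : Addv W 3 := hO6.2.1
  have hj : 0 ≤ padicValRat 3 W.j := hO6.padicValRat_j_nonneg
  have hirr : W.HasIrreducibleModPGaloisRep 3 := by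
    haveI : NeZero ((3 : ℕ) : ℚ) := ⟨by norm_num⟩
    exact hasIrreducibleModPGaloisRep_of_hasSurjectiveModNGaloisRep W 3 (by exact_mod_cast h1)
  have hGZK : rank_eq_analyticRank_of_analyticRank_le_one := hF.2.2.1
  have hmod : hasEntireLFunction_rat := hF.2.2.2.1
  have hKo' : ∀ (N : ℕ) [NeZero N] (W : WeierstrassCurve ℚ) (K : Type) [Field K] [NumberField K],
      Literature.NumberTheory.EllipticCurves.kolyvagin N W K := hF.2.1
  refine bsdp_of_indexHalves_of_twistHalvesOdd_row 3 (by decide) hF W haddv hr ?_ ?_ ?_ ?_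
  · -- STEP L: frame (20928) + Eisenstein inclusion (20479) + control (facts) + value (LZZ)
    intro N _ K _ _ Dt H ι P hN hK hHN _hodd hd4 hLt hP hnt
    exact indexLowerBoundLeAt_of_unrFrame_of_unrInclLe_of_control (by decide) hL Dt H ι P haddv hN hK hHN hd4 hP hnt
      (hKo' N W K) (fun κ hκ γ _ 𝔭 h𝔭 ↦ hFr W N K Dt hO6 hN hK hHN κ hκ γ 𝔭 h𝔭)
      (fun κ hκ γ _ 𝔭 h𝔭 he hf 𝔭' h𝔭' hne ι' hind ΩK Ωp L hΩK hΩp hBDP htors ↦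
        hX W N K Dt hO6 h1 hr hN hK hHN κ hκ γ 𝔭 h𝔭 he hf 𝔭' h𝔭' hne ι' hind ΩK Ωp L hΩK hΩp hBDP htors)
      (fun κ hκ γ _ 𝔭 h𝔭 he hf ↦
        additiveControl_heegner_potSS_of_facts_of_serre1967 hPT hPT2 hEP hcd hBr hBr2 hS 3 W N K Dt H ι P (Or.inr hO6) hirr
          hN hK hHN hP hnt (hKo' N W K) κ hκ γ 𝔭 h𝔭 he hf)
  · -- co-STEP L: Ko (20480)
    intro N _ K _ _ Dt H ι P hN hK hHN hodd hd4 hLt hP hnt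
    exact hKo W N K Dt H ι P hO6 h1 hr hN hK hHN hLt hP hnt hodd (by omega) hT
  · -- the twist's r = 0 LOWER half: K9's L₀ at `Wd`
    intro N _ K _ _ Wd _ _ hN hK hHN hodd _hd4 hC hLt
    obtain ⟨Cd, hCd⟩ := hC
    have hHN' : SatisfiesHeegnerHypothesis (W.conductorNorm ℤ) K := hN ▸ hHN
    obtain ⟨hO6d, -⟩ := classO6_twist_of_heegner W hO6 K hK hHN' hodd Wd Cd hCd
    have hD0 : (NumberField.discr K : ℚ) ≠ 0 := by exact_mod_cast NumberField.discr_ne_zero K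
    haveI : (W.quadraticTwist (NumberField.discr K : ℚ)).IsElliptic := W.isElliptic_quadraticTwist hD0
    have hLd1 : Wd.entireLFunction 1 ≠ 0 := by rw [← hCd, entireLFunction_smul]; exact hLt
    exact hL0 Wd (analyticRank_eq_zero_of_entireLFunction_one_ne_zero Wd hLd1) hO6d
  · -- the twist's r = 0 UPPER half: Kato A161″
    intro N _ K _ _ Wd _ _ hN hK hHN _hodd _hd4 hC hLt
    exact missingUpperBoundAt_twist_of_towerSurj_of_katoTam 3 (by decide) hKatoT hGZK hmod W haddv hj hsurj hN K hK hHN Wd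
      hC hLt

/-- **The same in 19200's currency `MissingPPartAt W 3`** (`Ш(E/ℚ)` finite by GZK): on the tower-onto wild rank-one rows,
K9's residual follows from the texts of UTD 20928, SOED 20479, SOED 20480 and K9's L₀ 19195, modulo A161″, the seven facts, LZZ
and the published inputs. CONDITIONAL; closes nothing.
[cite: JetchevSkinnerWan2017, §7.4.1 (arXiv:1512.06894 p. 30)] [cite: Kato2004Asterisque, Thm. 14.5 (3), Prop. 14.16 (2)] -/
theorem missingPPartAt_wildRankOne_towerSurj_of_frame20928_of_eisenstein20479_of_kolyvagin20480_of_L0_of_katoTam_of_facts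
    (hL : LiuZhangZhang2018.thm151_thm153_modularCurve_heegnerVector_additive)
    (hF : ToricPublishedInputs)
    (hKatoT : Kato2004.rankZero_padicValNat_sha_add_padicValNat_tamagawa_le_of_additive_potGood_of_imageContainsSL2)
    (hPT : ∀ (K : Type) [Field K] [NumberField K], poitouTate_selmerStructure_duality K)
    (hPT2 : ∀ (K : Type) [Field K] [NumberField K], poitouTate_sha_tateDual K)
    (hEP : ∀ (K : Type) [Field K] [NumberField K] (v : HeightOneSpectrum (𝓞 K)),
      localEulerPoincareCharacteristic (v.adicCompletion K))
    (hcd : fieldCdLE_two_of_numberField)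
    (hBr : ∀ (K : Type) [Field K] [NumberField K] (p : ℕ) [Fact p.Prime],
      ZpExtension.decomp_not_le_kerSubgroup_of_isAnticyclotomic K p)
    (hBr2 : ∀ (K : Type) [Field K] [NumberField K] (p : ℕ) [Fact p.Prime],
      ZpExtension.decomp_not_le_kerSubgroup_above_of_isAnticyclotomic K p)
    (hS : Serre1967.noStableDivisibleLine_of_potentiallySupersingular)
    (hFr : ∀ (W : WeierstrassCurve ℚ) [W.IsElliptic] [W.IsGloballyMinimal] (N : ℕ) [NeZero N] (K : Type) [Field K]
      [NumberField K] (Dt : ModularParametrizationData W N), ClassO6 W 3 → W.conductorNorm ℤ = N → IsImaginaryQuadratic K →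
      SatisfiesHeegnerHypothesis N K → ∀ (κ : ZpExtension K 3), κ.IsAnticyclotomic →
      ∀ (γ : Field.absoluteGaloisGroup K) [Fact (κ.IsTopGenerator γ)] (𝔭 : HeightOneSpectrum (𝓞 K)),
        ((3 : ℕ) : 𝓞 K) ∈ 𝔭.asIdeal → ∃ ι' : PadicAlgCl 3 ≃+* ℂ, SchneiderFree.BranchInducesPrime 3 ι' 𝔭 ∧
          ∃ (ΩK : ℂ) (Ωp : ℂ_[3]) (L : UnrSeries 3), ΩK ≠ 0 ∧ Ωp ≠ 0 ∧ IsBDPLFunction ι' 𝔭 κ γ Dt.f ΩK Ωp L)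
    (hX : ∀ (W : WeierstrassCurve ℚ) [W.IsElliptic] [W.IsGloballyMinimal] (N : ℕ) [NeZero N] (K : Type) [Field K]
      [NumberField K] (Dt : ModularParametrizationData W N), ClassO6 W 3 → W.HasSurjectiveModNGaloisRep 3 →
      W.analyticRank = 1 → W.conductorNorm ℤ = N → IsImaginaryQuadratic K → SatisfiesHeegnerHypothesis N K →
      ∀ (κ : ZpExtension K 3), κ.IsAnticyclotomic → ∀ (γ : Field.absoluteGaloisGroup K) [Fact (κ.IsTopGenerator γ)]
        (𝔭 : HeightOneSpectrum (𝓞 K)), ((3 : ℕ) : 𝓞 K) ∈ 𝔭.asIdeal → 𝔭.asIdeal.ramificationIdx (𝓞 ℚ) = 1 →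
        𝔭.asIdeal.inertiaDeg (𝓞 ℚ) = 1 → ∀ (𝔭' : HeightOneSpectrum (𝓞 K)), ((3 : ℕ) : 𝓞 K) ∈ 𝔭'.asIdeal → 𝔭' ≠ 𝔭 →
        ∀ (ι' : PadicAlgCl 3 ≃+* ℂ), SchneiderFree.BranchInducesPrime 3 ι' 𝔭 →
        ∀ (ΩK : ℂ) (Ωp : ℂ_[3]) (L : UnrSeries 3), ΩK ≠ 0 → Ωp ≠ 0 → IsBDPLFunction ι' 𝔭 κ γ Dt.f ΩK Ωp L →
          Module.IsTorsion (IwasawaAlgebra 3) (XAc (W.baseChange K) 3 κ 𝔭' ∅ γ) →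
          (XAc.charIdeal (W.baseChange K) 3 κ 𝔭' ∅ γ).map (PowerSeries.map (toUnr 3)) ≤ Ideal.span {L})
    (hKo : ∀ (W : WeierstrassCurve ℚ) [W.IsElliptic] [W.IsGloballyMinimal] (N : ℕ) [NeZero N] (K : Type) [Field K]
      [NumberField K] (Dt : ModularParametrizationData W N) (H : HeegnerDatum N (NumberField.discr K)) (ι : K →+* ℂ)
      (P : (W.baseChange K).toAffine.Point), ClassO6 W 3 → W.HasSurjectiveModNGaloisRep 3 → W.analyticRank = 1 →
      W.conductorNorm ℤ = N → IsImaginaryQuadratic K → SatisfiesHeegnerHypothesis N K →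
      (W.quadraticTwist (NumberField.discr K : ℚ)).entireLFunction 1 ≠ 0 →
      WeierstrassCurve.Affine.Point.map ι.toRatAlgHom P = heegnerPointComplex Dt H → ¬ IsOfFinAddOrder P →
      Odd (NumberField.discr K) → NumberField.discr K ≠ -3 → AdditiveThree.TowerSurjThree W →
      SchneiderFree.Upper.IndexUpperBoundLeAt W 3 K P (padicValNat 3 Dt.c.natAbs))
    (hL0 : ∀ (W : WeierstrassCurve ℚ) [W.IsElliptic] [W.IsGloballyMinimal] [Fact (3 : ℕ).Prime], W.analyticRank = 0 →
      ClassO6 W 3 → MissingLowerBoundAt W 3) :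
    ∀ (W : WeierstrassCurve ℚ) [W.IsElliptic] [W.IsGloballyMinimal], W.analyticRank = 1 → ClassO6 W 3 →
      AdditiveThree.TowerSurjThree W → MissingPPartAt W 3 := by
  intro W _ _ hr hO6 hT
  have hGZK : rank_eq_analyticRank_of_analyticRank_le_one := hF.2.2.1
  haveI : Finite W.sha := (hGZK W (by omega)).2
  exact missingPPartAt_of_bsdp W 3
    (bsdp_wildRankOne_towerSurj_of_frame20928_of_eisenstein20479_of_kolyvagin20480_of_L0_of_katoTam_of_facts hL hF hKatoT hPT
      hPT2 hEP hcd hBr hBr2 hS hFr hX hKo hL0 W hr hO6 hT)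

end RouteTexts

end Summit.BirchSwinnertonDyer.BirchSwinnertonDyer.Theorems.UniversalToricDescentWaldspurgerFlat

end
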